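import Summits.AtomisticToContinuum.HydrodynamicLimit.Theorems.EnskogAdjointDualityAdjointEnskogTestFamilyRKernelDipolePrep

/-!
# Dipole kernel (`ℓ = 1`) of the adjoint Enskog test family: the reduced dual gain

Second helper file for the stub `kernelDipole` of the refutation line of
`AdjointEnskogTestFamilyR`: the two elementary `t`-integrals
`∫₀¹ t³e^{-E(1-t²)/2}dt = 1/E - 2/E² + 2e^{-E/2}/E²` and `∫₀¹ tE(1-t²)e^{-E(1-t²)/2}dt ≤ 2/E`,
the bound `(1+E)^k e^{-E/c} ≤ (ck)^k`, and the decomposition of the reduced dual gain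
`∫_{-1}^{1} t² e^{-E(1-t²)/2} h(√E t) Θ̄¹_R(Et²) dt = √E(Θ̄¹_R(E) J₃(E) + D) + I₂` with explicit bounds on
`D` (freezing `Θ̄¹_R(Et²)` at `t = 1`) and `I₂` (the Gaussian remainder of `h`).  Here
`ϑ¹_R(E) = √E (1+E)⁻⁴ e^{-E/R}` and `Θ̄¹_R(x) = ∫_{E > x} ϑ¹_R` are written out explicitly.
-/

noncomputable section

namespace Summit.AtomisticToContinuum.HydrodynamicLimit.Theorems.EnskogAdjointDuality

open MeasureTheory Set Filter
open scoped Real Topology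

/-! ### Elementary `t`-integrals and exponential-times-polynomial bounds -/

/-- `∫₀¹ t³ e^{-E(1-t²)/2} dt = 1/E - 2/E² + 2e^{-E/2}/E²` for `E ≠ 0`. -/
theorem k2r_ref_K1_J3 {E : ℝ} (hE : E ≠ 0) :
    ∫ t in (0:ℝ)..1, t ^ 3 * Real.exp (-(E * (1 - t ^ 2)) / 2)
      = 1 / E - 2 / E ^ 2 + 2 * Real.exp (-E / 2) / E ^ 2 := by
  have hderiv : ∀ t ∈ uIcc (0:ℝ) 1, HasDerivAt (fun t => (t ^ 2 / E - 2 / E ^ 2) * Real.exp (-(E * (1 - t ^ 2)) / 2))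
      (t ^ 3 * Real.exp (-(E * (1 - t ^ 2)) / 2)) t := by
    intro t _
    have h1 : HasDerivAt (fun t : ℝ => -(E * (1 - t ^ 2)) / 2) (E * t) t := by
      have := ((((hasDerivAt_id' t).fun_pow 2).const_sub 1).const_mul E).neg.div_const 2
      refine this.congr_deriv ?_
      simp; ring
    have h2 : HasDerivAt (fun t : ℝ => t ^ 2 / E - 2 / E ^ 2) (2 * t / E) t := by
      have := (((hasDerivAt_id' t).fun_pow 2).div_const E).sub_const (2 / E ^ 2)
      refine this.congr_deriv ?_
      simp
    refine (h2.fun_mul h1.exp).congr_deriv ?_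
    field_simp
    ring
  rw [intervalIntegral.integral_eq_sub_of_hasDerivAt hderiv (by apply Continuous.intervalIntegrable; fun_prop)]
  simp only [one_pow, sub_self, mul_zero, neg_zero, zero_div, Real.exp_zero, mul_one, ne_eq,
    OfNat.ofNat_ne_zero, not_false_eq_true, zero_pow, sub_zero, zero_div, zero_sub]
  rw [neg_div]
  ring

/-- `∫₀¹ t E(1-t²) e^{-E(1-t²)/2} dt ≤ 2/E` for `E > 0` (exact value `2/E - (2/E+1)e^{-E/2}`). -/
theorem k2r_ref_K1_Kint_le {E : ℝ} (hE : 0 < E) :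
    ∫ t in (0:ℝ)..1, t * (E * (1 - t ^ 2)) * Real.exp (-(E * (1 - t ^ 2)) / 2) ≤ 2 / E := by
  have hderiv : ∀ t ∈ uIcc (0:ℝ) 1, HasDerivAt (fun t => (2 / E + (1 - t ^ 2)) * Real.exp (-(E * (1 - t ^ 2)) / 2))
      (t * (E * (1 - t ^ 2)) * Real.exp (-(E * (1 - t ^ 2)) / 2)) t := by
    intro t _
    have h1 : HasDerivAt (fun t : ℝ => -(E * (1 - t ^ 2)) / 2) (E * t) t := by
      have := ((((hasDerivAt_id' t).fun_pow 2).const_sub 1).const_mul E).neg.div_const 2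
      refine this.congr_deriv ?_
      simp; ring
    have h2 : HasDerivAt (fun t : ℝ => 2 / E + (1 - t ^ 2)) (-(2 * t)) t := by
      have := (((hasDerivAt_id' t).fun_pow 2).const_sub 1).const_add (2 / E)
      refine this.congr_deriv ?_
      simp
    refine (h2.fun_mul h1.exp).congr_deriv ?_
    field_simp
    ring
  rw [intervalIntegral.integral_eq_sub_of_hasDerivAt hderiv (by apply Continuous.intervalIntegrable; fun_prop)]
  simp only [one_pow, sub_self, mul_zero, neg_zero, zero_div, Real.exp_zero, mul_one, ne_eq,
    OfNat.ofNat_ne_zero, not_false_eq_true, zero_pow, sub_zero, add_zero]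
  have : 0 ≤ (2 / E + 1) * Real.exp (-E / 2) := by positivity
  linarith

/-- `(1+E)^k e^{-E/c} ≤ (ck)^k` for `E ≥ 0`, `c > 0`, `ck ≥ 1`. -/
theorem k2r_ref_K1_pow_exp_le {E c : ℝ} {k : ℕ} (hE : 0 ≤ E) (hc : 0 < c) (hk : 1 ≤ c * k) :
    (1 + E) ^ k * Real.exp (-(E / c)) ≤ (c * k) ^ k := by
  have hkpos : (0:ℝ) < k := by
    rcases Nat.eq_zero_or_pos k with h0 | h0
    · subst h0; simp at hk; linarith
    · exact_mod_cast h0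
  have hck : 0 < c * k := by positivity
  have h1 : 1 + E ≤ (c * k) * Real.exp (E / (c * k)) := by
    have h2 := Real.add_one_le_exp (E / (c * k))
    calc 1 + E ≤ c * k + E := by linarith
      _ = (c * k) * (E / (c * k) + 1) := by field_simp; ring
      _ ≤ (c * k) * Real.exp (E / (c * k)) := by gcongr
  have h3 : (1 + E) ^ k ≤ (c * k) ^ k * Real.exp (E / c) := by
    calc (1 + E) ^ k ≤ ((c * k) * Real.exp (E / (c * k))) ^ k := pow_le_pow_left₀ (by linarith) h1 k
      _ = (c * k) ^ k * Real.exp (E / c) := by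
        rw [mul_pow, ← Real.exp_nat_mul]
        congr 2; field_simp
  calc (1 + E) ^ k * Real.exp (-(E / c)) ≤ ((c * k) ^ k * Real.exp (E / c)) * Real.exp (-(E / c)) := by
        gcongr
    _ = (c * k) ^ k := by rw [mul_assoc, ← Real.exp_add]; simp

/-- `t ↦ Θ̄¹_R(E t²)` is interval integrable (bounded by `¼`, measurable), `E ≥ 0`. -/
theorem k2r_ref_K1_Tb_comp_intervalIntegrable {R E : ℝ} (hR : 0 < R) (hE : 0 ≤ E) (a b : ℝ) :
    IntervalIntegrable (fun t => (∫ y in Set.Ioi (E * t ^ 2), Real.sqrt y * ((1 + y) ^ 4)⁻¹ * Real.exp (-y / R))) volume a b := by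
  refine (Measure.integrableOn_of_bounded (s := uIcc a b) ?_ ?_ (M := 1 / 4) ?_).intervalIntegrable
  · exact measure_Icc_lt_top.ne
  · exact ((k2r_ref_K1_measurable_Tb hR).comp (by fun_prop)).aestronglyMeasurable
  · refine ae_of_all _ fun t => ?_
    have h0 : 0 ≤ E * t ^ 2 := by positivity
    rw [Real.norm_eq_abs, abs_of_nonneg (k2r_ref_K1_Tb_nonneg R _)]
    exact k2r_ref_K1_Tb_le_quarter hR h0

/-! ### Decomposition of the reduced dual gain integral -/

/-- **Decomposition of the reduced dual gain.** For `E > 0`, splitting `h = (·)₊ + r₁` with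
`0 ≤ r₁(a) ≤ e^{-a²/2}` and using `∫₀¹ t³e^{-E(1-t²)/2}dt` explicitly:
`∫_{-1}^{1} t² e^{-E(1-t²)/2} h(√E t) Θ̄¹_R(Et²) dt = √E (Θ̄¹_R(E)·J₃(E) + D) + I₂` with
`0 ≤ D ≤ (1+E/2)⁻³/E + E e^{-E/4}/2` and `|I₂| ≤ e^{-E/2}/2`. -/
theorem k2r_ref_K1_gain_decomp {h : ℝ → ℝ} (hc : Continuous h)
    (hh : ∀ a, 0 ≤ h a - max a 0 ∧ h a - max a 0 ≤ Real.exp (-a ^ 2 / 2)) {R E : ℝ} (hR : 0 < R)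
    (hE : 0 < E) :
    ∃ D I₂ : ℝ, 0 ≤ D ∧ D ≤ (1 / 2) * ((1 + E / 2) ^ 3)⁻¹ * (2 / E) + E * Real.exp (-(E / 4)) / 2 ∧
      |I₂| ≤ Real.exp (-(E / 2)) / 2 ∧
      (∫ t in (-1:ℝ)..1, t ^ 2 * Real.exp (-(E * (1 - t ^ 2)) / 2) * h (Real.sqrt E * t) *
          (∫ y in Set.Ioi (E * t ^ 2), Real.sqrt y * ((1 + y) ^ 4)⁻¹ * Real.exp (-y / R)))
        = Real.sqrt E * ((∫ y in Set.Ioi E, Real.sqrt y * ((1 + y) ^ 4)⁻¹ * Real.exp (-y / R)) * (1 / E - 2 / E ^ 2 + 2 * Real.exp (-E / 2) / E ^ 2) + D)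
          + I₂ := by
  have hΘi := k2r_ref_K1_Tb_comp_intervalIntegrable hR hE.le
  have hmaxc : Continuous fun t : ℝ => max (Real.sqrt E * t) 0 :=
    (continuous_const.mul continuous_id).max continuous_const
  -- the two pieces of the integrand
  have hF₁ : ∀ a b : ℝ, IntervalIntegrable (fun t => (t ^ 2 * Real.exp (-(E * (1 - t ^ 2)) / 2) *
      max (Real.sqrt E * t) 0) * (∫ y in Set.Ioi (E * t ^ 2), Real.sqrt y * ((1 + y) ^ 4)⁻¹ * Real.exp (-y / R))) volume a b := fun a b =>
    (hΘi a b).continuousOn_mul (Continuous.continuousOn (by fun_prop))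
  have hF₂ : IntervalIntegrable (fun t => (t ^ 2 * Real.exp (-(E * (1 - t ^ 2)) / 2) *
      (h (Real.sqrt E * t) - max (Real.sqrt E * t) 0)) * (∫ y in Set.Ioi (E * t ^ 2), Real.sqrt y * ((1 + y) ^ 4)⁻¹ * Real.exp (-y / R))) volume (-1) 1 :=
    (hΘi _ _).continuousOn_mul (Continuous.continuousOn (by fun_prop))
  have hF₃ : IntervalIntegrable (fun t => (t ^ 3 * Real.exp (-(E * (1 - t ^ 2)) / 2)) *
      (∫ y in Set.Ioi (E * t ^ 2), Real.sqrt y * ((1 + y) ^ 4)⁻¹ * Real.exp (-y / R))) volume 0 1 :=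
    (hΘi _ _).continuousOn_mul (Continuous.continuousOn (by fun_prop))
  have hF₄ : IntervalIntegrable (fun t => (t ^ 3 * Real.exp (-(E * (1 - t ^ 2)) / 2)) *
      ((∫ y in Set.Ioi (E * t ^ 2), Real.sqrt y * ((1 + y) ^ 4)⁻¹ * Real.exp (-y / R)) - (∫ y in Set.Ioi E, Real.sqrt y * ((1 + y) ^ 4)⁻¹ * Real.exp (-y / R)))) volume 0 1 := by
    have : IntervalIntegrable (fun t => (t ^ 3 * Real.exp (-(E * (1 - t ^ 2)) / 2)) *
        (∫ y in Set.Ioi E, Real.sqrt y * ((1 + y) ^ 4)⁻¹ * Real.exp (-y / R))) volume 0 1 := Continuous.intervalIntegrable (by fun_prop) _ _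
    simpa [mul_sub] using hF₃.sub this
  -- Step 1: split h = (·)₊ + r₁
  have hsplit : (∫ t in (-1:ℝ)..1, t ^ 2 * Real.exp (-(E * (1 - t ^ 2)) / 2) * h (Real.sqrt E * t) *
        (∫ y in Set.Ioi (E * t ^ 2), Real.sqrt y * ((1 + y) ^ 4)⁻¹ * Real.exp (-y / R)))
      = (∫ t in (-1:ℝ)..1, (t ^ 2 * Real.exp (-(E * (1 - t ^ 2)) / 2) * max (Real.sqrt E * t) 0) *
          (∫ y in Set.Ioi (E * t ^ 2), Real.sqrt y * ((1 + y) ^ 4)⁻¹ * Real.exp (-y / R)))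
        + ∫ t in (-1:ℝ)..1, (t ^ 2 * Real.exp (-(E * (1 - t ^ 2)) / 2) *
          (h (Real.sqrt E * t) - max (Real.sqrt E * t) 0)) * (∫ y in Set.Ioi (E * t ^ 2), Real.sqrt y * ((1 + y) ^ 4)⁻¹ * Real.exp (-y / R)) := by
    rw [← intervalIntegral.integral_add (hF₁ _ _) hF₂]
    refine intervalIntegral.integral_congr fun t _ => ?_
    ring
  -- Step 2: the `(·)₊` piece lives on `[0, 1]`
  have hneg : (∫ t in (-1:ℝ)..0, (t ^ 2 * Real.exp (-(E * (1 - t ^ 2)) / 2) * max (Real.sqrt E * t) 0) *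
      (∫ y in Set.Ioi (E * t ^ 2), Real.sqrt y * ((1 + y) ^ 4)⁻¹ * Real.exp (-y / R))) = 0 := by
    rw [intervalIntegral.integral_congr (g := fun _ => (0:ℝ)) ?_, intervalIntegral.integral_zero]
    intro t ht
    rw [uIcc_of_le (by norm_num)] at ht
    have : max (Real.sqrt E * t) 0 = 0 :=
      max_eq_right (mul_nonpos_of_nonneg_of_nonpos (Real.sqrt_nonneg E) ht.2)
    simp [this]
  have hpos : (∫ t in (0:ℝ)..1, (t ^ 2 * Real.exp (-(E * (1 - t ^ 2)) / 2) * max (Real.sqrt E * t) 0) *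
      (∫ y in Set.Ioi (E * t ^ 2), Real.sqrt y * ((1 + y) ^ 4)⁻¹ * Real.exp (-y / R)))
      = Real.sqrt E * ∫ t in (0:ℝ)..1, (t ^ 3 * Real.exp (-(E * (1 - t ^ 2)) / 2)) *
          (∫ y in Set.Ioi (E * t ^ 2), Real.sqrt y * ((1 + y) ^ 4)⁻¹ * Real.exp (-y / R)) := by
    rw [← intervalIntegral.integral_const_mul]
    refine intervalIntegral.integral_congr fun t ht => ?_
    rw [uIcc_of_le zero_le_one] at ht
    have : max (Real.sqrt E * t) 0 = Real.sqrt E * t := max_eq_left (by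
      have := ht.1; positivity)
    simp only [this]; ring
  have h01 : (∫ t in (-1:ℝ)..1, (t ^ 2 * Real.exp (-(E * (1 - t ^ 2)) / 2) * max (Real.sqrt E * t) 0) *
      (∫ y in Set.Ioi (E * t ^ 2), Real.sqrt y * ((1 + y) ^ 4)⁻¹ * Real.exp (-y / R)))
      = Real.sqrt E * ∫ t in (0:ℝ)..1, (t ^ 3 * Real.exp (-(E * (1 - t ^ 2)) / 2)) *
          (∫ y in Set.Ioi (E * t ^ 2), Real.sqrt y * ((1 + y) ^ 4)⁻¹ * Real.exp (-y / R)) := by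
    rw [← intervalIntegral.integral_add_adjacent_intervals (hF₁ (-1) 0) (hF₁ 0 1), hneg, zero_add, hpos]
  -- Step 3: freeze `Θ̄(E t²)` at `t = 1`
  have hmain : (∫ t in (0:ℝ)..1, (t ^ 3 * Real.exp (-(E * (1 - t ^ 2)) / 2)) * (∫ y in Set.Ioi (E * t ^ 2), Real.sqrt y * ((1 + y) ^ 4)⁻¹ * Real.exp (-y / R)))
      = (∫ y in Set.Ioi E, Real.sqrt y * ((1 + y) ^ 4)⁻¹ * Real.exp (-y / R)) * (1 / E - 2 / E ^ 2 + 2 * Real.exp (-E / 2) / E ^ 2)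
        + ∫ t in (0:ℝ)..1, (t ^ 3 * Real.exp (-(E * (1 - t ^ 2)) / 2)) *
            ((∫ y in Set.Ioi (E * t ^ 2), Real.sqrt y * ((1 + y) ^ 4)⁻¹ * Real.exp (-y / R)) - (∫ y in Set.Ioi E, Real.sqrt y * ((1 + y) ^ 4)⁻¹ * Real.exp (-y / R))) := by
    rw [← k2r_ref_K1_J3 hE.ne', ← intervalIntegral.integral_const_mul,
      ← intervalIntegral.integral_add (Continuous.intervalIntegrable (by fun_prop) _ _) hF₄]
    refine intervalIntegral.integral_congr fun t _ => ?_
    ring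
  -- Step 4: bounds on D
  set D := ∫ t in (0:ℝ)..1, (t ^ 3 * Real.exp (-(E * (1 - t ^ 2)) / 2)) *
            ((∫ y in Set.Ioi (E * t ^ 2), Real.sqrt y * ((1 + y) ^ 4)⁻¹ * Real.exp (-y / R)) - (∫ y in Set.Ioi E, Real.sqrt y * ((1 + y) ^ 4)⁻¹ * Real.exp (-y / R))) with hDdef
  have hΔ0 : ∀ t ∈ Icc (0:ℝ) 1, 0 ≤ (∫ y in Set.Ioi (E * t ^ 2), Real.sqrt y * ((1 + y) ^ 4)⁻¹ * Real.exp (-y / R)) - (∫ y in Set.Ioi E, Real.sqrt y * ((1 + y) ^ 4)⁻¹ * Real.exp (-y / R)) := by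
    intro t ht
    have ht2 : t ^ 2 ≤ 1 := by nlinarith [ht.1, ht.2]
    exact sub_nonneg.mpr (k2r_ref_K1_Tb_antitone hR (by nlinarith))
  have hD0 : 0 ≤ D := by
    apply intervalIntegral.integral_nonneg zero_le_one
    intro t ht
    have := ht.1
    have := hΔ0 t ht
    positivity
  have hptw : ∀ t ∈ Icc (0:ℝ) 1, (t ^ 3 * Real.exp (-(E * (1 - t ^ 2)) / 2)) *
      ((∫ y in Set.Ioi (E * t ^ 2), Real.sqrt y * ((1 + y) ^ 4)⁻¹ * Real.exp (-y / R)) - (∫ y in Set.Ioi E, Real.sqrt y * ((1 + y) ^ 4)⁻¹ * Real.exp (-y / R)))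
      ≤ (1 / 2) * ((1 + E / 2) ^ 3)⁻¹ * (t * (E * (1 - t ^ 2)) * Real.exp (-(E * (1 - t ^ 2)) / 2))
        + E * Real.exp (-(E / 4)) / 2 := by
    intro t ht
    obtain ⟨ht0, ht1⟩ := ht
    have ht2 : t ^ 2 ≤ 1 := by nlinarith
    have hEt : 0 ≤ E * t ^ 2 := by positivity
    have hEt' : E * t ^ 2 ≤ E := by nlinarith
    have hinc := k2r_ref_K1_Tb_sub_le hR hEt hEt'
    have hΔ := hΔ0 t ⟨ht0, ht1⟩
    have hA0 : 0 ≤ (1 / 2) * ((1 + E / 2) ^ 3)⁻¹ * (t * (E * (1 - t ^ 2)) *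
        Real.exp (-(E * (1 - t ^ 2)) / 2)) := by
      have : 0 ≤ 1 - t ^ 2 := by linarith
      positivity
    have hB0 : 0 ≤ E * Real.exp (-(E / 4)) / 2 := by positivity
    rcases le_or_gt (1 / 2) (t ^ 2) with hcase | hcase
    · have h3 : ((1 + E * t ^ 2) ^ 3)⁻¹ ≤ ((1 + E / 2) ^ 3)⁻¹ := by
        apply inv_anti₀ (by positivity)
        gcongr
        nlinarith
      have ht3 : t ^ 3 ≤ t := by nlinarith
      calc (t ^ 3 * Real.exp (-(E * (1 - t ^ 2)) / 2)) * ((∫ y in Set.Ioi (E * t ^ 2), Real.sqrt y * ((1 + y) ^ 4)⁻¹ * Real.exp (-y / R)) - (∫ y in Set.Ioi E, Real.sqrt y * ((1 + y) ^ 4)⁻¹ * Real.exp (-y / R)))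
          ≤ (t * Real.exp (-(E * (1 - t ^ 2)) / 2)) *
              ((E - E * t ^ 2) * ((1 / 2) * ((1 + E * t ^ 2) ^ 3)⁻¹)) := by gcongr
        _ ≤ (t * Real.exp (-(E * (1 - t ^ 2)) / 2)) *
              ((E - E * t ^ 2) * ((1 / 2) * ((1 + E / 2) ^ 3)⁻¹)) := by
            have : 0 ≤ E - E * t ^ 2 := by linarith
            gcongr
        _ = (1 / 2) * ((1 + E / 2) ^ 3)⁻¹ * (t * (E * (1 - t ^ 2)) * Real.exp (-(E * (1 - t ^ 2)) / 2)) := by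
            ring
        _ ≤ _ := le_add_of_nonneg_right hB0
    · have hex4 : Real.exp (-(E * (1 - t ^ 2)) / 2) ≤ Real.exp (-(E / 4)) := by
        rw [Real.exp_le_exp]; nlinarith
      have hΔ2 : (∫ y in Set.Ioi (E * t ^ 2), Real.sqrt y * ((1 + y) ^ 4)⁻¹ * Real.exp (-y / R)) - (∫ y in Set.Ioi E, Real.sqrt y * ((1 + y) ^ 4)⁻¹ * Real.exp (-y / R)) ≤ E / 2 := by
        refine hinc.trans ?_
        have h4 : ((1 + E * t ^ 2) ^ 3)⁻¹ ≤ 1 :=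
          inv_le_one_of_one_le₀ (one_le_pow₀ (by linarith : (1:ℝ) ≤ 1 + E * t ^ 2))
        calc (E - E * t ^ 2) * ((1 / 2) * ((1 + E * t ^ 2) ^ 3)⁻¹) ≤ E * ((1 / 2) * 1) := by
              gcongr
              linarith
          _ = E / 2 := by ring
      have ht3 : t ^ 3 ≤ 1 := pow_le_one₀ ht0 ht1
      calc (t ^ 3 * Real.exp (-(E * (1 - t ^ 2)) / 2)) * ((∫ y in Set.Ioi (E * t ^ 2), Real.sqrt y * ((1 + y) ^ 4)⁻¹ * Real.exp (-y / R)) - (∫ y in Set.Ioi E, Real.sqrt y * ((1 + y) ^ 4)⁻¹ * Real.exp (-y / R)))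
          ≤ (1 * Real.exp (-(E / 4))) * (E / 2) := by gcongr
        _ = E * Real.exp (-(E / 4)) / 2 := by ring
        _ ≤ _ := le_add_of_nonneg_left hA0
  have hDle : D ≤ (1 / 2) * ((1 + E / 2) ^ 3)⁻¹ * (2 / E) + E * Real.exp (-(E / 4)) / 2 := by
    have hKi : IntervalIntegrable (fun t => t * (E * (1 - t ^ 2)) * Real.exp (-(E * (1 - t ^ 2)) / 2))
        volume 0 1 := Continuous.intervalIntegrable (by fun_prop) _ _
    calc D ≤ ∫ t in (0:ℝ)..1, ((1 / 2) * ((1 + E / 2) ^ 3)⁻¹ *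
          (t * (E * (1 - t ^ 2)) * Real.exp (-(E * (1 - t ^ 2)) / 2)) + E * Real.exp (-(E / 4)) / 2) :=
          intervalIntegral.integral_mono_on zero_le_one hF₄
            ((hKi.const_mul _).add (Continuous.intervalIntegrable (by fun_prop) _ _)) hptw
      _ = (1 / 2) * ((1 + E / 2) ^ 3)⁻¹ *
            (∫ t in (0:ℝ)..1, t * (E * (1 - t ^ 2)) * Real.exp (-(E * (1 - t ^ 2)) / 2))
          + E * Real.exp (-(E / 4)) / 2 := by
          rw [intervalIntegral.integral_add (hKi.const_mul _) (Continuous.intervalIntegrable (by fun_prop) _ _),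
            intervalIntegral.integral_const_mul, intervalIntegral.integral_const]
          simp
      _ ≤ (1 / 2) * ((1 + E / 2) ^ 3)⁻¹ * (2 / E) + E * Real.exp (-(E / 4)) / 2 := by
          gcongr; exact k2r_ref_K1_Kint_le hE
  -- Step 5: the `r₁` piece is exponentially small
  set I₂ := ∫ t in (-1:ℝ)..1, (t ^ 2 * Real.exp (-(E * (1 - t ^ 2)) / 2) *
          (h (Real.sqrt E * t) - max (Real.sqrt E * t) 0)) * (∫ y in Set.Ioi (E * t ^ 2), Real.sqrt y * ((1 + y) ^ 4)⁻¹ * Real.exp (-y / R)) with hI₂def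
  have hI₂ : |I₂| ≤ Real.exp (-(E / 2)) / 2 := by
    have key := intervalIntegral.norm_integral_le_of_norm_le_const (a := (-1:ℝ)) (b := 1)
      (C := Real.exp (-(E / 2)) / 4)
      (f := fun t => (t ^ 2 * Real.exp (-(E * (1 - t ^ 2)) / 2) *
          (h (Real.sqrt E * t) - max (Real.sqrt E * t) 0)) * (∫ y in Set.Ioi (E * t ^ 2), Real.sqrt y * ((1 + y) ^ 4)⁻¹ * Real.exp (-y / R))) ?_
    · rw [Real.norm_eq_abs] at key
      calc |I₂| ≤ Real.exp (-(E / 2)) / 4 * |1 - (-1)| := key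
        _ = Real.exp (-(E / 2)) / 2 := by norm_num; ring
    · intro t ht
      obtain ⟨hr0, hr1⟩ := hh (Real.sqrt E * t)
      have ht2 : t ^ 2 ≤ 1 := by
        rw [uIoc_of_le (by norm_num)] at ht
        nlinarith [ht.1, ht.2]
      have hEt : 0 ≤ E * t ^ 2 := by positivity
      have hΘ0 := k2r_ref_K1_Tb_nonneg R (E * t ^ 2)
      have hΘ1 := k2r_ref_K1_Tb_le_quarter hR hEt
      have hprod : Real.exp (-(E * (1 - t ^ 2)) / 2) * Real.exp (-(Real.sqrt E * t) ^ 2 / 2)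
          = Real.exp (-(E / 2)) := by
        rw [← Real.exp_add]; congr 1; rw [mul_pow, Real.sq_sqrt hE.le]; ring
      rw [Real.norm_eq_abs, abs_of_nonneg (by positivity)]
      calc t ^ 2 * Real.exp (-(E * (1 - t ^ 2)) / 2) * (h (Real.sqrt E * t) - max (Real.sqrt E * t) 0) *
            (∫ y in Set.Ioi (E * t ^ 2), Real.sqrt y * ((1 + y) ^ 4)⁻¹ * Real.exp (-y / R))
          ≤ 1 * Real.exp (-(E * (1 - t ^ 2)) / 2) * Real.exp (-(Real.sqrt E * t) ^ 2 / 2) * (1 / 4) := by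
            gcongr
        _ = Real.exp (-(E / 2)) / 4 := by rw [one_mul, hprod]; ring
  refine ⟨D, I₂, hD0, hDle, hI₂, ?_⟩
  rw [hsplit, h01, hmain]

/-- Keyed sub-goal of the stub `kernelDipole` (second prep file): the elementary integral `J₃`. -/
theorem stub_kernelDipole_prep2 : ∀ E : ℝ, E ≠ 0 → (∫ t in (0 : ℝ)..1, t ^ 3 * Real.exp (-(E * (1 - t ^ 2)) / 2)) = 1 / E - 2 / E ^ 2 + 2 * Real.exp (-E / 2) / E ^ 2 :=
  fun _ hE => k2r_ref_K1_J3 hE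

end Summit.AtomisticToContinuum.HydrodynamicLimit.Theorems.EnskogAdjointDuality
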